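import Literature.AnabelianGeometry.EtaleTheta.Thm56SubdagCodomainsGlue
import Literature.AnabelianGeometry.EtaleTheta.Discharge.Sec5Prop55TransportIndependentCod
import Literature.AnabelianGeometry.EtaleTheta.Discharge.Sec5Prop55OfLawsOfBiKummerData

/-!
# [EtTh] Prop. 5.5 in the VARYING-CODOMAIN currency at the GENUINE §5 data (PDF pp. 101–102 = printed 327–328)

Mochizuki, *The étale theta function and its Frobenioid-theoretic manifestations*, Publ. RIMS **45** (2009)
[cite: MochizukiEtTh2009, Prop 5.5 p.327–328 (PDF pp.101–102)].  abc-iut cell, layer L2, row «CyclotomicRigidityCod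
ASSEMBLY at the genuine §5 data» (abc-iut-L2-lead RULINGS #1 (gen 3) R7; plan/L2/SUBDAG-EtTh-Thm56.md rows P55-L04/L05/L06,
P55-A; seat abc-iut-w5-d020 gen 3).  PROOF-ONLY (no definitions, no new named fact).

Print (p.327 l.−6 – p.328 l.11) transports the isomorphism `(l·Δ_Θ)_{S″} ⊗ ℤ/Nℤ ⥲ μ_N(S″)` from VARYING admissible
sources `S″` — «`l·N`-codomains of `l·N`-th roots of right fraction-pairs of `Θ̈`» — to every `(l, N)`-theta-saturated
`S` by linear morphisms; abc-iut-w5-d020's `Thm56Sub.CyclotomicRigidityCod 𝔉 hcodSat ν` (p420185) is Prop. 5.5 in that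
currency (existence ∧ uniqueness relative to the native isomorphisms `ν` at ALL admissible codomains; abc-iut-L2-lead
ruling F-w5d123-3 / finding F-w5d020-1), abc-iut-w4-d008's `Thm56Sub.cyclotomicRigidityCod_of_galois` (p421674) derives it
from the printed structural laws.  This file ASSEMBLES it for abc-iut-L2-t4's genuine §5 data
`𝔉 := ThetaFrobenioid.ofBiKummerData …` (W3-L2-01; every level of the tower `ThetaFrobenioidTower.ofBiKummerFamily` IS
such data, `atLevel_ofBiKummerFamily_eq_ofBiKummerData`, rfl):
* `cyclotomicRigidityCod_ofBiKummerData` — for ANY admissible class `IsCod`, with the unit-transport laws (U)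
  (abc-iut-w4-d008's `unitsPullCongrBase_ofBiKummerData`), `unitsPull_comp/_id` DISCHARGED at the model;
* the PRINT-FAITHFUL class at the data: the codomains `(Rι i).BN` of a family `Rι` of `N`-th root data of the SAME
  fraction-pair in the SAME §4 setting (each with its §5 auxiliaries — base-Frobenius sections `σι`, constants, the
  divisor-descent inputs of p.330–331); there «`B_N` is Aut-ample» (p.330 (PDF p.104)) HOLDS at every codomain
  (`isAutAmple_rootCodomain_ofBiKummerData`, from abc-iut-L2-t4's `autAmpleBN_ofBiKummerData`), giving
  `cyclotomicRigidityCod_ofBiKummerData_roots` modulo exactly: the native isos `ν` (Prop. 5.2 (iii)/Prop. 1.3 at each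
  root), their functoriality among codomains (Fc, «manifestly "functorial"», p.328 l.1–2), reachability from codomains
  (abc-iut-w5-d123's `ReachableFromCodomains` shape, [FrdI] Def. 1.3 (i)(b)), co-filtration of the codomains (a), the Galois
  torsor property of codomain bases (b) (= abc-iut-w4-d008's (G) class), and the two laws of the free subquotient stub `Q`;
* the BRIDGE back to abc-iut-L2-t4's node statement: `Thm56Sub.rigidityFamily_exists_of_cyclotomicRigidityCod` — the
  EXISTENCE clause of `CyclotomicRigidity 𝔉 P hB` (a functorial family Kummer-determined on `B_N` through `P`) follows from
  the varying-codomain proposition + the `(η, ν_{B_N})` pin (Prop. 5.2 (iii)) + P55-L02/L02b, WITHOUT the fixed-source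
  reachability `LinearlyReachableFromBN` (flagged stronger than print); at the data `rigidityFamily_exists_ofBiKummerData_of_cod`
  (η-side: abc-iut-w5-d123's `exists_eta_etaTautological_ofBiKummerData`; centrality: T56-L09b `unitsCentralUnderLDelta_ofBiKummerData`).
HONEST FRAMING: kernel-checked implications between typed statements about the assembled §5 data; nothing of [EtTh]
is asserted unconditionally; nothing asserts that such data exist for an actual curve; typed ≠ discharged; no side
taken on [IUTchIII] Cor. 3.12.
-/

noncomputable section

namespace Literature.AnabelianGeometry.EtaleTheta

open CategoryTheory Opposite FrobenioidCyclotomicRigidity Literature.AlgebraicGeometry.Frobenioids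

universe u₀ v₀ u v w w₁ v₁ v₁' u₁ u₁'

namespace ThetaFrobenioid

/-! ### The bridge (abstract §5 data): existence on `B_N` from the varying-codomain proposition -/

namespace Thm56Sub

variable {C : Type u₁} [Category.{v₁} C] {D : Type u₁'} [Category.{v₁'} D] {𝔉 : ThetaFrobenioid.{w₁} C D}
  {IsCod : C → Prop}

/-- **Prop. 5.5, existence clause of abc-iut-L2-t4's fixed-codomain statement FROM the varying-codomain one** (p.327
l.−6 – p.328 l.11): if `CyclotomicRigidityCod 𝔉 hcodSat ν` holds, `B_N` is itself an admissible codomain, and at `B_N` the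
bi-Kummer difference cocycle is `ν_{B_N} ∘ η` up to a coboundary (Prop. 5.2 (iii), `ThetaPairKummerClass`) with `η`
tautological on the `Δ`-part (P55-L02) and that part centralising `μ_N(B_N)` (P55-L02b), then there is a rigidity family
that is functorial for linear morphisms, Kummer-determined on `B_N` THROUGH `P` (abc-iut-L2-t4's `IsKummerDetermined`) and
Kummer-determined at every codomain — no reachability FROM `B_N` is used.
[cite: MochizukiEtTh2009, Prop 5.5 p.327–328 (PDF pp.101–102)] -/
theorem rigidityFamily_exists_of_cyclotomicRigidityCod (hcodSat : ∀ S'', IsCod S'' → 𝔉.IsThetaSaturated S'')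
    (ν : NativeIsoFamily 𝔉 IsCod) (hcod : CyclotomicRigidityCod 𝔉 hcodSat ν) (hBcod : IsCod 𝔉.BN)
    (P : ThetaSubquotientProj 𝔉) {η : 𝔉.HB → 𝔉.lDeltaModN 𝔉.BN}
    (hK : FrobenioidThetaBiKummer.ThetaPairKummerClass 𝔉 η (ν 𝔉.BN hBcod)) (hη : EtaTautological 𝔉 P η)
    (hc : CyclotomeCentralUnderLDelta 𝔉 P) :
    ∃ ρ : RigidityFamily 𝔉, IsKummerDetermined 𝔉 P ρ (hcodSat 𝔉.BN hBcod) ∧ IsFunctorialLinear 𝔉 ρ ∧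
      IsKummerDeterminedCod 𝔉 hcodSat ν ρ := by
  obtain ⟨⟨ρ, hKc, hρ⟩, -⟩ := hcod
  exact ⟨ρ, isKummerDetermined_of_thetaPair 𝔉 P hK hη hc ρ (hcodSat 𝔉.BN hBcod) (hKc 𝔉.BN hBcod), hρ, hKc⟩

/-- The same with the theta-saturation witness of `B_N` supplied separately (proof-irrelevant rewrite), in the exact
shape of the existence clause of abc-iut-L2-t4's `CyclotomicRigidity 𝔉 P hB`.
[cite: MochizukiEtTh2009, Prop 5.5 p.327–328 (PDF pp.101–102)] -/
theorem rigidityFamily_exists_of_cyclotomicRigidityCod' (hcodSat : ∀ S'', IsCod S'' → 𝔉.IsThetaSaturated S'')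
    (ν : NativeIsoFamily 𝔉 IsCod) (hcod : CyclotomicRigidityCod 𝔉 hcodSat ν) (hBcod : IsCod 𝔉.BN)
    (hB : 𝔉.IsThetaSaturated 𝔉.BN) (P : ThetaSubquotientProj 𝔉) {η : 𝔉.HB → 𝔉.lDeltaModN 𝔉.BN}
    (hK : FrobenioidThetaBiKummer.ThetaPairKummerClass 𝔉 η (ν 𝔉.BN hBcod)) (hη : EtaTautological 𝔉 P η)
    (hc : CyclotomeCentralUnderLDelta 𝔉 P) :
    ∃ ρ : RigidityFamily 𝔉, IsKummerDetermined 𝔉 P ρ hB ∧ IsFunctorialLinear 𝔉 ρ ∧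
      IsKummerDeterminedCod 𝔉 hcodSat ν ρ :=
  rigidityFamily_exists_of_cyclotomicRigidityCod hcodSat ν hcod hBcod P hK hη hc

end Thm56Sub

/-! ### At the genuine §5 data `ofBiKummerData` -/

variable {K : Type u₀} [Field K]
  {X : SemiGraphs.TemperedArithmeticGroup.{u₀} K} {D₀ : Type u₀} [Category.{v₀} D₀]
  {V : FrdIMonoidStub.{w}} {T₀ : RealifiedDivisorMonoids (D₀ := D₀) V} {D : Type u} [Category.{v} D]
  {VD : FrdICatStub.{u, v, w} D} {S : BiKummerSetting X T₀ D VD}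
  {pullFrac : ∀ {A A' : S.C} (_ : A' ⟶ A), S.biratUnits A → S.biratUnits A'}
  {lv N : ℕ+} {l' : ℕ} {RD : RigidData.{max v w} N l'} {θ : S.biratUnits S.Aodot} {Bl : S.C}
  {Pl : S.FractionPair θ Bl} {Rl : S.NthRoot θ Pl lv pullFrac}
  (h : ModelFrobenioid.Hypotheses S.tf.divisorMonoid S.tf.ratFnFunctor)
  (toB : ∀ A : S.C, S.biratUnits A →* S.tf.biratUnitsModel A) (Q : FrobenioidTheta.ThetaSubquotientStub.{w} D)
  (odd_l : Odd (lv : ℕ)) (R : S.NthRoot Rl.root Rl.pair N pullFrac) (ιX : RD.PiX ≃ₜ* X.Pi)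
  (hopen : IsOpen ((S.galoisSurj R.AN.base R.αData.isGalois).ker : Set X.Pi)) (σ : Aut R.AN.base →* Aut R.AN)
  (K' : Type w) [Field K'] (constEmb : K'ˣ →* S.tf.biratUnitsModel R.BN)
  (constEmb_injective : Function.Injective constEmb)
  (hdivc : ∀ g : Aut R.BN.base,
    ModelFrobenioid.div ((σ ((BiKummerSetting.NthRoot.baseIso S R).conjAut.symm g)).hom ≫ R.pair.num) =
      ModelFrobenioid.div R.pair.num)
  (hdivp : ∀ y : RD.PiYdd,
    ModelFrobenioid.div ((σ (S.galoisSurj R.AN.base R.αData.isGalois (ιX y.1))).hom ≫ R.pair.den) =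
      ModelFrobenioid.div R.pair.den)

/-- **[EtTh] Proposition 5.5 in the varying-codomain currency for the ASSEMBLED §5 data, any admissible class** —
`CyclotomicRigidityCod (ofBiKummerData …) hcodSat ν` (existence ∧ uniqueness, relative to the native isos `ν` at all
admissible codomains, of a rigidity family functorial for linear morphisms of `(l, N)`-theta-saturated objects) from
abc-iut-w4-d008's `cyclotomicRigidityCod_of_galois` with the unit-transport laws (U), `UnitsPullComp`, `UnitsPullId`
DISCHARGED at the model; named inputs: `ν`, `hcodSat`, `hreach` (abc-iut-w5-d123's `ReachableFromCodomains`), (Fc) `hfun`,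
(a) `hcof`, (b) `hgalCod`, (c) `hample`, and the laws `hLc`/`hLi` of the free subquotient stub `Q`.
[cite: MochizukiEtTh2009, Prop 5.5 p.327–328 (PDF pp.101–102)] -/
theorem cyclotomicRigidityCod_ofBiKummerData {IsCod : S.C → Prop}
    (hcodSat : ∀ S'', IsCod S'' →
      (ofBiKummerData h toB Q odd_l R ιX hopen σ K' constEmb constEmb_injective hdivc hdivp).IsThetaSaturated S'')
    (ν : Thm56Sub.NativeIsoFamily
      (ofBiKummerData h toB Q odd_l R ιX hopen σ K' constEmb constEmb_injective hdivc hdivp) IsCod)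
    (hreach : ReachableFromCodomains
      (ofBiKummerData h toB Q odd_l R ιX hopen σ K' constEmb constEmb_injective hdivc hdivp) IsCod)
    (hLc : Thm56Sub.LDeltaMapComp
      (ofBiKummerData h toB Q odd_l R ιX hopen σ K' constEmb constEmb_injective hdivc hdivp))
    (hLi : Thm56Sub.LDeltaMapId
      (ofBiKummerData h toB Q odd_l R ιX hopen σ K' constEmb constEmb_injective hdivc hdivp))
    (hfun : ∀ (S₁ S₂ : S.C) (h₁ : IsCod S₁) (h₂ : IsCod S₂) (ψ : S₁ ⟶ S₂),
      (ofBiKummerData h toB Q odd_l R ιX hopen σ K' constEmb constEmb_injective hdivc hdivp).IsLinear ψ →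
      ∀ x : (ofBiKummerData h toB Q odd_l R ιX hopen σ K' constEmb constEmb_injective hdivc hdivp).lDeltaModN S₁,
        (ofBiKummerData h toB Q odd_l R ιX hopen σ K' constEmb constEmb_injective hdivc hdivp).muTorsionPull ψ
            (ofBiKummerData h toB Q odd_l R ιX hopen σ K' constEmb constEmb_injective hdivc hdivp).N
            (ν S₂ h₂ ((ofBiKummerData h toB Q odd_l R ιX hopen σ K' constEmb constEmb_injective hdivc hdivp).lDeltaModNMap
              ψ x)) = ν S₁ h₁ x)
    (hcof : ∀ (S₁ S₂ : S.C), IsCod S₁ → IsCod S₂ →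
      ∃ (S₀ : S.C) (_ : IsCod S₀) (ψ₁ : S₀ ⟶ S₁) (ψ₂ : S₀ ⟶ S₂),
        (ofBiKummerData h toB Q odd_l R ιX hopen σ K' constEmb constEmb_injective hdivc hdivp).IsLinear ψ₁ ∧
        (ofBiKummerData h toB Q odd_l R ιX hopen σ K' constEmb constEmb_injective hdivc hdivp).IsLinear ψ₂ ∧
        Function.Surjective
          ((ofBiKummerData h toB Q odd_l R ιX hopen σ K' constEmb constEmb_injective hdivc hdivp).lDeltaModNMap ψ₁) ∧
        Function.Surjective
          ((ofBiKummerData h toB Q odd_l R ιX hopen σ K' constEmb constEmb_injective hdivc hdivp).lDeltaModNMap ψ₂) ∧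
        Function.Injective
          ((ofBiKummerData h toB Q odd_l R ιX hopen σ K' constEmb constEmb_injective hdivc hdivp).muTorsionPull ψ₂
            (ofBiKummerData h toB Q odd_l R ιX hopen σ K' constEmb constEmb_injective hdivc hdivp).N))
    (hgalCod : ∀ (T : S.C),
      (ofBiKummerData h toB Q odd_l R ιX hopen σ K' constEmb constEmb_injective hdivc hdivp).IsThetaSaturated T →
      ∀ (S₀ : S.C), IsCod S₀ → ∀ (f f' : S₀ ⟶ T),
        (ofBiKummerData h toB Q odd_l R ιX hopen σ K' constEmb constEmb_injective hdivc hdivp).IsLinear f →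
        (ofBiKummerData h toB Q odd_l R ιX hopen σ K' constEmb constEmb_injective hdivc hdivp).IsLinear f' →
          ∃ g : Aut ((ofBiKummerData h toB Q odd_l R ιX hopen σ K' constEmb constEmb_injective hdivc hdivp).base.obj S₀),
            (ofBiKummerData h toB Q odd_l R ιX hopen σ K' constEmb constEmb_injective hdivc hdivp).base.map f' =
              g.hom ≫ (ofBiKummerData h toB Q odd_l R ιX hopen σ K' constEmb constEmb_injective hdivc hdivp).base.map f)
    (hample : ∀ (S₀ : S.C), IsCod S₀ →
      (ofBiKummerData h toB Q odd_l R ιX hopen σ K' constEmb constEmb_injective hdivc hdivp).IsAutAmple S₀) :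
    Thm56Sub.CyclotomicRigidityCod
      (ofBiKummerData h toB Q odd_l R ιX hopen σ K' constEmb constEmb_injective hdivc hdivp) hcodSat ν :=
  Thm56Sub.cyclotomicRigidityCod_of_galois hcodSat ν hreach
    (unitsPullComp_ofBiKummerData h toB Q odd_l R ιX hopen σ K' constEmb constEmb_injective hdivc hdivp)
    (unitsPullId_ofBiKummerData h toB Q odd_l R ιX hopen σ K' constEmb constEmb_injective hdivc hdivp) hLc hLi
    (fun φ ψ _ _ hb => unitsPullCongrBase_ofBiKummerData h toB Q odd_l R ιX hopen σ K' constEmb constEmb_injective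
      hdivc hdivp φ ψ hb)
    hfun hcof hgalCod hample

/-! ### The print-faithful admissible class at the data: codomains of a family of roots of the same fraction-pair -/

section Roots

variable {ι : Type*} (Rι : ι → S.NthRoot Rl.root Rl.pair N pullFrac)
  (hopenι : ∀ i, IsOpen ((S.galoisSurj (Rι i).AN.base (Rι i).αData.isGalois).ker : Set X.Pi))
  (σι : ∀ i, Aut (Rι i).AN.base →* Aut (Rι i).AN)
  (constEmbι : ∀ i, K'ˣ →* S.tf.biratUnitsModel (Rι i).BN)
  (constEmbι_injective : ∀ i, Function.Injective (constEmbι i))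
  (hdivcι : ∀ (i) (g : Aut (Rι i).BN.base),
    ModelFrobenioid.div ((σι i ((BiKummerSetting.NthRoot.baseIso S (Rι i)).conjAut.symm g)).hom ≫ (Rι i).pair.num) =
      ModelFrobenioid.div (Rι i).pair.num)
  (hdivpι : ∀ (i) (y : RD.PiYdd),
    ModelFrobenioid.div ((σι i (S.galoisSurj (Rι i).AN.base (Rι i).αData.isGalois (ιX y.1))).hom ≫ (Rι i).pair.den) =
      ModelFrobenioid.div (Rι i).pair.den)

include hopenι constEmbι constEmbι_injective hdivcι hdivpι

/-- **«`B_N` is Aut-ample» (p.330 (PDF p.104)) at EVERY root codomain**: for each root datum `Rι i` of the family (with its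
base-Frobenius section `σι i`, a section by `hσι`, and the divisor-descent input `hdivcι i` of p.330), the codomain
`(Rι i).BN` is Aut-ample for the assembled data — abc-iut-L2-t4's `autAmpleBN_ofBiKummerData` for the data assembled at
THAT root (same underlying pre-Frobenioid, rfl), read as the tree's `IsAutAmple` ([FrdI] Def. 1.2 (iv)).
[cite: MochizukiEtTh2009, §5 p.330–331 (PDF pp.104–105)] -/
theorem isAutAmple_rootCodomain_ofBiKummerData
    (hσι : ∀ (i) (g : Aut (Rι i).AN.base), ModelFrobenioid.baseMap (σι i g).hom = g.hom) (i : ι) :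
    (ofBiKummerData h toB Q odd_l R ιX hopen σ K' constEmb constEmb_injective hdivc hdivp).IsAutAmple (Rι i).BN := by
  intro β
  -- `Aut_C(B) → Aut_D(B^bs)` is onto for the data assembled AT the root `Rι i` (abc-iut-L2-t4), and that map is the same
  -- map for the data assembled at `R` (one underlying pre-Frobenioid)
  obtain ⟨α, hα⟩ := autAmpleBN_ofBiKummerData h toB Q odd_l (Rι i) ιX (hopenι i) (σι i) K' (constEmbι i)
    (constEmbι_injective i) (hdivcι i) (hdivpι i) (hσι i) β
  exact ⟨α, hα⟩

/-- **[EtTh] Proposition 5.5 in the varying-codomain currency for the ASSEMBLED §5 data, print's admissible class** —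
sources = the codomains `(Rι i).BN` of the root data `Rι i` («`l·N`-codomains of `l·N`-th roots of right fraction-pairs
of `Θ̈`», p.327 l.−6; Prop. 5.2 (i)): `CyclotomicRigidityCod (ofBiKummerData …) hcodSat ν` with (U), `UnitsPullComp/Id`
AND the Aut-ampleness (c) of every codomain DISCHARGED; named inputs exactly: the native isos `ν` (Prop. 5.2 (iii) /
Prop. 1.3 at each root), `hcodSat` (Def. 5.4 at each codomain), `hreach` (abc-iut-w5-d123's `ReachableFromCodomains`;
[FrdI] Def. 1.3 (i)(b)), (Fc) `hfun` («manifestly "functorial" … with respect to `l·N`-codomains», p.328 l.1–2), (a) `hcof`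
(co-filtration of the root codomains by linear arrows inducing isomorphisms, p.328 l.2–8), (b) `hgalCod` (codomain bases
are Galois: abc-iut-w4-d008's (G) torsor class), and the laws `hLc`/`hLi` of the free subquotient stub `Q`.
[cite: MochizukiEtTh2009, Prop 5.5 p.327–328 (PDF pp.101–102)] -/
theorem cyclotomicRigidityCod_ofBiKummerData_roots
    (hσι : ∀ (i) (g : Aut (Rι i).AN.base), ModelFrobenioid.baseMap (σι i g).hom = g.hom)
    (hcodSat : ∀ S'', (∃ i, (Rι i).BN = S'') →
      (ofBiKummerData h toB Q odd_l R ιX hopen σ K' constEmb constEmb_injective hdivc hdivp).IsThetaSaturated S'')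
    (ν : Thm56Sub.NativeIsoFamily
      (ofBiKummerData h toB Q odd_l R ιX hopen σ K' constEmb constEmb_injective hdivc hdivp) (fun S'' => ∃ i, (Rι i).BN = S''))
    (hreach : ReachableFromCodomains
      (ofBiKummerData h toB Q odd_l R ιX hopen σ K' constEmb constEmb_injective hdivc hdivp) (fun S'' => ∃ i, (Rι i).BN = S''))
    (hLc : Thm56Sub.LDeltaMapComp
      (ofBiKummerData h toB Q odd_l R ιX hopen σ K' constEmb constEmb_injective hdivc hdivp))
    (hLi : Thm56Sub.LDeltaMapId
      (ofBiKummerData h toB Q odd_l R ιX hopen σ K' constEmb constEmb_injective hdivc hdivp))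
    (hfun : ∀ (S₁ S₂ : S.C) (h₁ : ∃ i, (Rι i).BN = S₁) (h₂ : ∃ i, (Rι i).BN = S₂) (ψ : S₁ ⟶ S₂),
      (ofBiKummerData h toB Q odd_l R ιX hopen σ K' constEmb constEmb_injective hdivc hdivp).IsLinear ψ →
      ∀ x : (ofBiKummerData h toB Q odd_l R ιX hopen σ K' constEmb constEmb_injective hdivc hdivp).lDeltaModN S₁,
        (ofBiKummerData h toB Q odd_l R ιX hopen σ K' constEmb constEmb_injective hdivc hdivp).muTorsionPull ψ
            (ofBiKummerData h toB Q odd_l R ιX hopen σ K' constEmb constEmb_injective hdivc hdivp).N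
            (ν S₂ h₂ ((ofBiKummerData h toB Q odd_l R ιX hopen σ K' constEmb constEmb_injective hdivc hdivp).lDeltaModNMap
              ψ x)) = ν S₁ h₁ x)
    (hcof : ∀ (S₁ S₂ : S.C), (∃ i, (Rι i).BN = S₁) → (∃ i, (Rι i).BN = S₂) →
      ∃ (S₀ : S.C) (_ : ∃ i, (Rι i).BN = S₀) (ψ₁ : S₀ ⟶ S₁) (ψ₂ : S₀ ⟶ S₂),
        (ofBiKummerData h toB Q odd_l R ιX hopen σ K' constEmb constEmb_injective hdivc hdivp).IsLinear ψ₁ ∧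
        (ofBiKummerData h toB Q odd_l R ιX hopen σ K' constEmb constEmb_injective hdivc hdivp).IsLinear ψ₂ ∧
        Function.Surjective
          ((ofBiKummerData h toB Q odd_l R ιX hopen σ K' constEmb constEmb_injective hdivc hdivp).lDeltaModNMap ψ₁) ∧
        Function.Surjective
          ((ofBiKummerData h toB Q odd_l R ιX hopen σ K' constEmb constEmb_injective hdivc hdivp).lDeltaModNMap ψ₂) ∧
        Function.Injective
          ((ofBiKummerData h toB Q odd_l R ιX hopen σ K' constEmb constEmb_injective hdivc hdivp).muTorsionPull ψ₂
            (ofBiKummerData h toB Q odd_l R ιX hopen σ K' constEmb constEmb_injective hdivc hdivp).N))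
    (hgalCod : ∀ (T : S.C),
      (ofBiKummerData h toB Q odd_l R ιX hopen σ K' constEmb constEmb_injective hdivc hdivp).IsThetaSaturated T →
      ∀ (S₀ : S.C), (∃ i, (Rι i).BN = S₀) → ∀ (f f' : S₀ ⟶ T),
        (ofBiKummerData h toB Q odd_l R ιX hopen σ K' constEmb constEmb_injective hdivc hdivp).IsLinear f →
        (ofBiKummerData h toB Q odd_l R ιX hopen σ K' constEmb constEmb_injective hdivc hdivp).IsLinear f' →
          ∃ g : Aut ((ofBiKummerData h toB Q odd_l R ιX hopen σ K' constEmb constEmb_injective hdivc hdivp).base.obj S₀),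
            (ofBiKummerData h toB Q odd_l R ιX hopen σ K' constEmb constEmb_injective hdivc hdivp).base.map f' =
              g.hom ≫ (ofBiKummerData h toB Q odd_l R ιX hopen σ K' constEmb constEmb_injective hdivc hdivp).base.map f) :
    Thm56Sub.CyclotomicRigidityCod
      (ofBiKummerData h toB Q odd_l R ιX hopen σ K' constEmb constEmb_injective hdivc hdivp) hcodSat ν := by
  refine cyclotomicRigidityCod_ofBiKummerData h toB Q odd_l R ιX hopen σ K' constEmb constEmb_injective hdivc hdivp
    hcodSat ν hreach hLc hLi hfun hcof hgalCod ?_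
  rintro S₀ ⟨i, rfl⟩
  exact isAutAmple_rootCodomain_ofBiKummerData h toB Q odd_l R ιX hopen σ K' constEmb constEmb_injective hdivc hdivp
    Rι hopenι σι constEmbι constEmbι_injective hdivcι hdivpι hσι i

end Roots

/-! ### The bridge at the data: existence on `B_N` through `P`, without reachability from `B_N` -/

/-- **[EtTh] Prop. 5.5 at the ASSEMBLED data — the EXISTENCE clause of abc-iut-L2-t4's `CyclotomicRigidity (ofBiKummerData …) P hB`
from the varying-codomain proposition**, print-faithfully (no `LinearlyReachableFromBN`): given `CyclotomicRigidityCod`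
at the data for an admissible class containing `B_N` (`hBcod`), the η-side of the Prop. 5.2 (iii) pin (abc-iut-w5-d123:
the mod-`N` theta cocycle `η₀` descends along `ρ` — `hdies` — to an `η` tautological on the `Δ`-part, P55-L02) whose
`ν`-half IS the native iso at `B_N` (`hK`), and the centrality of the geometric part (T56-L09b at the data, from `hσ`,
`hgeom`, `hconst`), there is a rigidity family functorial for linear morphisms, Kummer-determined on `B_N` through `P` and
at every codomain.  [cite: MochizukiEtTh2009, Prop 5.5 p.327–328 (PDF pp.101–102)] -/
theorem rigidityFamily_exists_ofBiKummerData_of_cod {IsCod : S.C → Prop}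
    (hcodSat : ∀ S'', IsCod S'' →
      (ofBiKummerData h toB Q odd_l R ιX hopen σ K' constEmb constEmb_injective hdivc hdivp).IsThetaSaturated S'')
    (ν : Thm56Sub.NativeIsoFamily
      (ofBiKummerData h toB Q odd_l R ιX hopen σ K' constEmb constEmb_injective hdivc hdivp) IsCod)
    (hcod : Thm56Sub.CyclotomicRigidityCod
      (ofBiKummerData h toB Q odd_l R ιX hopen σ K' constEmb constEmb_injective hdivc hdivp) hcodSat ν)
    (hBcod : IsCod R.BN)
    (hB : (ofBiKummerData h toB Q odd_l R ιX hopen σ K' constEmb constEmb_injective hdivc hdivp).IsThetaSaturated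
      (ofBiKummerData h toB Q odd_l R ιX hopen σ K' constEmb constEmb_injective hdivc hdivp).BN)
    (P : ThetaSubquotientProj (ofBiKummerData h toB Q odd_l R ιX hopen σ K' constEmb constEmb_injective hdivc hdivp))
    -- the η-side (abc-iut-w5-d123, P55-L02 at the carrier)
    {η₀ : RD.PiYdd → RD.mu} (hη₀ : η₀ ∈ RD.thetaCocycles)
    (hdies : ∀ k : RD.PiYdd, rhoOfBiKummerData R ιX k = 1 → η₀ k = 1)
    (e : RD.mu → (ofBiKummerData h toB Q odd_l R ιX hopen σ K' constEmb constEmb_injective hdivc hdivp).lDeltaModN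
      (ofBiKummerData h toB Q odd_l R ιX hopen σ K' constEmb constEmb_injective hdivc hdivp).BN)
    (hlift : ∀ a ∈ (ofBiKummerData h toB Q odd_l R ιX hopen σ K' constEmb constEmb_injective hdivc hdivp).HB,
      a ∈ P.pre _ → ∃ k : RD.PiYdd, (k : RD.PiX) ∈ RD.lDeltaTheta ∧ rhoOfBiKummerData R ιX k = a)
    (hP : ∀ (k : RD.PiYdd) (hk : (k : RD.PiX) ∈ RD.lDeltaTheta) (hm : rhoOfBiKummerData R ιX k ∈ P.pre _),
      (QuotientGroup.mk (P.proj _ ⟨rhoOfBiKummerData R ιX k, hm⟩) :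
          (ofBiKummerData h toB Q odd_l R ιX hopen σ K' constEmb constEmb_injective hdivc hdivp).lDeltaModN
            (ofBiKummerData h toB Q odd_l R ιX hopen σ K' constEmb constEmb_injective hdivc hdivp).BN) =
        e (RD.thetaMod ⟨k, hk⟩))
    -- the ν-half of the Prop. 5.2 (iii) pin IS the native iso at `B_N`, for the descended η
    (hK : ∀ η : (ofBiKummerData h toB Q odd_l R ιX hopen σ K' constEmb constEmb_injective hdivc hdivp).HB →
        (ofBiKummerData h toB Q odd_l R ιX hopen σ K' constEmb constEmb_injective hdivc hdivp).lDeltaModN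
          (ofBiKummerData h toB Q odd_l R ιX hopen σ K' constEmb constEmb_injective hdivc hdivp).BN,
      (∀ k : RD.PiYdd, η ⟨rhoOfBiKummerData R ιX k, Subgroup.mem_map_of_mem _ k.2⟩ = e (η₀ k)) →
        FrobenioidThetaBiKummer.ThetaPairKummerClass
          (ofBiKummerData h toB Q odd_l R ιX hopen σ K' constEmb constEmb_injective hdivc hdivp) η (ν R.BN hBcod))
    -- centrality of the geometric part (T56-L09b at the data)
    (hσ : ∀ g : Aut R.AN.base, ModelFrobenioid.baseMap (σ g).hom = g.hom)
    (hgeom : P.pre R.BN.base ≤ RD.aug.ker.map (rhoOfBiKummerData R ιX))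
    (hconst : ∀ δ ∈ RD.aug.ker, ∀ τ : ModelFrobenioid.units R.BN,
      (S.tf.ratFnFunctor.map (rhoOfBiKummerData R ιX δ).hom.op).hom (ModelFrobenioid.unit τ.1.hom) =
        ModelFrobenioid.unit τ.1.hom) :
    ∃ ρ : RigidityFamily (ofBiKummerData h toB Q odd_l R ιX hopen σ K' constEmb constEmb_injective hdivc hdivp),
      IsKummerDetermined (ofBiKummerData h toB Q odd_l R ιX hopen σ K' constEmb constEmb_injective hdivc hdivp) P ρ hB ∧
      IsFunctorialLinear (ofBiKummerData h toB Q odd_l R ιX hopen σ K' constEmb constEmb_injective hdivc hdivp) ρ ∧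
      Thm56Sub.IsKummerDeterminedCod
        (ofBiKummerData h toB Q odd_l R ιX hopen σ K' constEmb constEmb_injective hdivc hdivp) hcodSat ν ρ := by
  -- the descended, tautological η (abc-iut-w5-d123)
  obtain ⟨η, hηdesc, hηtaut⟩ := exists_eta_etaTautological_ofBiKummerData h toB Q odd_l R ιX hopen σ K' constEmb
    constEmb_injective hdivc hdivp hη₀ hdies e P hlift hP
  exact Thm56Sub.rigidityFamily_exists_of_cyclotomicRigidityCod' hcodSat ν hcod hBcod hB P (hK η hηdesc) hηtaut
    (Thm56Sub.cyclotomeCentral_of_unitsCentral _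
      (unitsCentralUnderLDelta_ofBiKummerData h toB Q odd_l R ιX hopen σ K' constEmb constEmb_injective hdivc hdivp
        hσ P hgeom hconst))

end ThetaFrobenioid

end Literature.AnabelianGeometry.EtaleTheta

end
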